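import Summits.CriticalPhenomena.PercolationContinuityZ3.Theorems.PercNearOneGluingNoHeavyQuantFiveAtomsHeavyB
import Summits.CriticalPhenomena.PercolationContinuityZ3.Theorems.PercNearOneGluingNoHeavyQuantFiveAtomsHeavyC
import Summits.CriticalPhenomena.PercolationContinuityZ3.Theorems.PercNearOneGluingNoHeavyQuantGluedFourComponents
import HarnessLib

/-!
# QUANT lane R8, T-DEC: FOUR EQUAL BLOBS ARE HEAVY-DEC AT THEIR AVERAGE GATE, and the lift `ρ ∗ ρ ∗ ρ ∗ gate_c ρ` (three sure glued
# siblings beside a gated copy) is DEC at floor `(3+c)g/4` — every shape `(r, k)`, long tails included (prim-quant-census-2 gen 80)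

builds on p205010 (kernel theorem, internal audit signed; external expert review pending)

Support file (`--supports stmt-CriticalPhenomena-4575`), QUANT lane census seat prim-quant-census-2 (gen 80); memo
`run/shared/lean/prim/quant/prim-quant-census-2-g80/TRIPLE-G80.md` §5.  Theorems only, standard axioms, no sorries, no definitions.
The width-4 analogue of `…QuantBlobAverageFloor` (three blobs, lift `ρ ∗ ρ ∗ gate_c ρ`).

THE BLOB LEMMA (**`heavy_fourBlobs`**).  The law of `k·(ξ₁ + ξ₂ + ξ₃ + ζ)`, `ξᵢ ~ Bernoulli(g)`, `ζ ~ Bernoulli(c·g)` independent — the mixture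
`(1−c)·[k·Bin(3,g)] + c·[k·Bin(4,g)]` on the atoms `0, k, 2k, 3k, 4k`, atom weights `p₀ = (1−g)³(1−cg)`, `p₁ = g(1−g)²(3+c−4cg)`,
`p₂ = 3g²(1−g)(1+c−2cg)`, `p₃ = g³(1+3c−4cg)`, `p₄ = c·g⁴`, mean `s = (3+c)g` — carries a HEAVY decomposition (`…QuantHeavyShift`: pairs with
gate `≥ x` and credit `≥ T`, self-sufficient points) at the floor `x = s/4` = the AVERAGE gate and the target `T = s·k` = its mean.  The five
regimes of `s` are the five-atom lemmas `heavy_fiveAtoms_r1/r2/r3lo/r3hi/r4` (`…QuantFiveAtomsHeavy{,B,C}`); what this file adds is the SIX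
POLYNOMIAL INEQUALITIES in `(c, g)` those lemmas take as hypotheses, for these particular atom weights: `HC2` (the atom `k` fits under `2k` at
the floor gate, `s > 2`), `HS` (`k` fits under `3k`, `s > 2`), `HZ` (the zero's overflow past `4k` fits under `3k` at gate `s/3`, `2 < s < 3`),
`HO` (from `HS`), and the separator of the regime `8/3 ≤ s < 3`: if `c ≤ 1 − g` the atom `k` fits under `2k` at gate `s − 2`, if `c ≥ 1 − g` the
zero fits under `4k` at the floor gate (which also serves `s ≥ 3`, where `c ≥ 1 − g` is automatic).  Each is a reduced inequality
(`fourBlobs_red_*`, `nlinarith` / monotone products) times a nonnegative monomial.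
THE LIFT (**`decAtT_threeSureOneGated`**).  `X₃ = ρ ∗ ρ ∗ ρ ∗ gate_c ρ`, `ρ = blobLaw [(k,g),(r,1)]`, is the blob law above with the gated
copy's atoms moved up by `r` (`heavy_shift_partial`, same target) and everything moved up by `3r` (`heavy_shift_full`, target `+6r ≥ (3+c)r`);
hence `X₃` is `DECAtT ((3+c)g/4) ((3+c)(r+kg)) j` at EVERY layer `j`, for every shape `(r, k)`.  USE: the polarized component
`ρ³ ∗ gate_{4m−3} ρ` of the identical glued quadruple's outer-gate mixture for `m > 3/4` (`…QuantGluedFourTrueFloor`).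

HONEST STATUS.  `SiblingStep`, `FarTreeRow` OPEN; RATE class (log\*) / honest sentence of `run/shared/lean/prim/quant/README.md` unchanged.
[this work].  Nothing here is cited as a published result.  The gluing rows served [cite: KozmaNitzan2024, Conjecture 3 (p. 15)]; product
measure [cite: Grimmett1999, §1.3 p. 10].
-/

noncomputable section

open scoped BigOperators

namespace Summit.CriticalPhenomena.PercolationContinuityZ3.Theorems
namespace Quant

open Finset

/-- the two-point law `{lo, hi; g}` (as in `…QuantLawDEC`) -/
local notation3 "TP[" lo ", " hi ", " g ", " h "]" =>
  (g : ℝ) * (if (h : ℕ) = (hi : ℕ) then (1 : ℝ) else 0) + (1 - (g : ℝ)) * (if (h : ℕ) = (lo : ℕ) then (1 : ℝ) else 0)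

namespace LawDec

/-! ### The six polynomial inequalities of the four-blob weights — reduced forms -/

/-- `HC2` reduced: `(3+c)(1−g)(3+c−4cg) ≤ 3(4 − (3+c)g)(1+c−2cg)` (used for `(3+c)g > 2`; true on the whole square). [this work] -/
theorem fourBlobs_red_C2 (c g : ℝ) (hc0 : 0 < c) (hc1 : c ≤ 1) (hg0 : 0 < g) (hg1 : g < 1) :
    (3 + c) * (1 - g) * (3 + c - 4 * c * g) ≤ 3 * (4 - (3 + c) * g) * (1 + c - 2 * c * g) := by
  nlinarith [mul_nonneg hc0.le (by linarith : 0 ≤ 1 - g), mul_pos hc0 hg0, mul_nonneg (mul_nonneg hc0.le hg0.le) (by linarith : 0 ≤ 1 - g),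
    mul_nonneg (by linarith : 0 ≤ 1 - c) (by linarith : 0 ≤ 1 - g)]

/-- `HS` auxiliary, in the variables `u = 1 − g`, `d = 1 − c`: `(2−d)u(3d + 4(1−d)u) ≤ (d + (4−d)u)(1−u)(d + 4(1−d)u)` for
`(4−d)u < 2−d`. [this work] -/
theorem fourBlobs_red_S_aux (u d : ℝ) (hu0 : 0 < u) (hd0 : 0 ≤ d) (hd1 : d < 1) (hs : (4 - d) * u < 2 - d) :
    (2 - d) * u * (3 * d + 4 * (1 - d) * u) ≤ (d + (4 - d) * u) * (1 - u) * (d + 4 * (1 - d) * u) := by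
  have hu12 : u < 1 / 2 := by nlinarith
  nlinarith [mul_nonneg hu0.le hd0, mul_nonneg (mul_nonneg hu0.le hd0) hd0, mul_nonneg (mul_nonneg hu0.le hu0.le) hd0,
    mul_nonneg (by linarith : 0 ≤ 2 - d - (4 - d) * u) hu0.le, mul_nonneg (mul_nonneg (by linarith : 0 ≤ 2 - d - (4 - d) * u) hu0.le) hd0,
    mul_nonneg (mul_nonneg (by linarith : 0 ≤ 2 - d - (4 - d) * u) hu0.le) hu0.le,
    mul_nonneg (mul_nonneg (by linarith : 0 ≤ 2 - d - (4 - d) * u) hu0.le) (by linarith : 0 ≤ 1 - d),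
    mul_nonneg (by linarith : 0 ≤ 1 - d) hu0.le, mul_nonneg (mul_nonneg (by linarith : 0 ≤ 1 - d) hu0.le) hu0.le,
    mul_nonneg (mul_nonneg hd0 (by linarith : 0 ≤ 1 - d)) hu0.le]

/-- `HS` reduced: `(3+c)(1−g)²(3+c−4cg) ≤ (4 − (3+c)g)·g·(1+3c−4cg)` for `(3+c)g > 2` (the auxiliary inequality read at `u = 1−g`,
`d = 1−c`, and `(3+c)(1−g) < 1+c`). [this work] -/
theorem fourBlobs_red_S (c g : ℝ) (hc0 : 0 < c) (hc1 : c ≤ 1) (hg1 : g < 1) (hs : 2 < (3 + c) * g) :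
    (3 + c) * (1 - g) ^ 2 * (3 + c - 4 * c * g) ≤ (4 - (3 + c) * g) * g * (1 + 3 * c - 4 * c * g) := by
  have hu : (3 + c) * (1 - g) < 1 + c := by linarith
  have hcg : c * g ≤ c := by nlinarith
  have hA0 : 0 ≤ (1 - g) * (3 + c - 4 * c * g) := mul_nonneg (by linarith) (by linarith)
  have h1 : (3 + c) * (1 - g) * ((1 - g) * (3 + c - 4 * c * g)) ≤ (1 + c) * ((1 - g) * (3 + c - 4 * c * g)) :=
    mul_le_mul_of_nonneg_right hu.le hA0
  have h2 := fourBlobs_red_S_aux (1 - g) (1 - c) (by linarith) (by linarith) (by linarith) (by linarith)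
  nlinarith [h1, h2]

/-- `HZ` reduced: `(3+c)(1−g)³(1−cg) − (4 − (3+c)g)·c·g³ ≤ (3 − (3+c)g)·g²·(1+3c−4cg)` for `2 < (3+c)g < 3`. [this work] -/
theorem fourBlobs_red_Z (c g : ℝ) (hc0 : 0 < c) (hc1 : c ≤ 1) (hg0 : 0 < g) (hg1 : g < 1) (hs : 2 < (3 + c) * g)
    (hs3 : (3 + c) * g < 3) :
    (3 + c) * (1 - g) ^ 3 * (1 - c * g) - (4 - (3 + c) * g) * c * g ^ 3 ≤ (3 - (3 + c) * g) * g ^ 2 * (1 + 3 * c - 4 * c * g) := by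
  have hg12 : 1 / 2 < g := by nlinarith
  have hpos : 0 < 3 * (1 - g) - c * g := by linarith
  nlinarith [mul_pos hc0 hg0, pow_pos hg0 3, mul_nonneg (mul_nonneg (by linarith : 0 ≤ 1 - g) (by linarith : 0 ≤ 1 - g)) (by linarith : 0 ≤ 1 - g),
    mul_nonneg (by linarith : 0 ≤ (3 + c) * g - 2) (by linarith : 0 ≤ 1 - g), sq_nonneg (1 - g), sq_nonneg g,
    mul_nonneg (mul_nonneg (by linarith : 0 ≤ (3 + c) * g - 2) (by linarith : 0 ≤ 1 - g)) (by linarith : 0 ≤ 1 - g),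
    mul_nonneg hpos.le (sq_nonneg g), mul_nonneg (mul_nonneg hpos.le (sq_nonneg g)) (by linarith : 0 ≤ 1 - c),
    mul_nonneg (sq_nonneg (1 - g)) (by nlinarith [mul_pos hc0 hg0] : 0 ≤ 1 - c * g)]

/-- separator, first half (reduced): for `c ≤ 1 − g` and `8/3 ≤ (3+c)g` (`< 3` follows) the atom `k` fits under `2k` at gate `s − 2`:
`((3+c)g − 2)(1−g)(3+c−4cg) ≤ 3(3 − (3+c)g)·g·(1+c−2cg)`. [this work] -/
theorem fourBlobs_red_one (c g : ℝ) (hc0 : 0 < c) (hg1 : g < 1) (hs : 8 / 3 ≤ (3 + c) * g) (hcu : c ≤ 1 - g) :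
    ((3 + c) * g - 2) * (1 - g) * (3 + c - 4 * c * g) ≤ 3 * (3 - (3 + c) * g) * g * (1 + c - 2 * c * g) := by
  have hg23 : 2 / 3 < g := by nlinarith
  have hc13 : c ≤ 1 / 3 := by linarith
  have hg45 : 4 / 5 ≤ g := by nlinarith
  have h3s : 2 * (1 - g) ≤ 3 - (3 + c) * g := by nlinarith
  have hL : ((3 + c) * g - 2) * (1 - g) * (3 + c - 4 * c * g) ≤ 3 * (1 - g) := by
    have h1 : (3 + c) * g - 2 ≤ 1 := by linarith
    have h2 : 3 + c - 4 * c * g ≤ 3 := by nlinarith [mul_pos hc0 (by linarith : (0 : ℝ) < g)]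
    have h3 : 0 ≤ 3 + c - 4 * c * g := by nlinarith
    have := mul_le_mul (mul_le_mul_of_nonneg_right h1 (by linarith : 0 ≤ 1 - g)) h2 h3 (by linarith)
    linarith
  have hR : 3 * (2 * (1 - g)) * (4 / 5) * (2 / 3) ≤ 3 * (3 - (3 + c) * g) * g * (1 + c - 2 * c * g) := by
    have h4 : 2 / 3 ≤ 1 + c - 2 * c * g := by nlinarith
    have := mul_le_mul (mul_le_mul (mul_le_mul_of_nonneg_left h3s (by norm_num : (0:ℝ) ≤ 3)) hg45 (by norm_num) (by linarith))
      h4 (by norm_num) (by nlinarith)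
    linarith
  linarith

/-- separator, second half (reduced): for `1 − g ≤ c` and `8/3 ≤ (3+c)g` the zero fits under `4k` at the floor gate:
`(3+c)(1−g)³(1−cg) ≤ (4 − (3+c)g)·c·g³`. [this work] -/
theorem fourBlobs_red_zero (c g : ℝ) (hc0 : 0 < c) (hc1 : c ≤ 1) (hg0 : 0 < g) (hg1 : g < 1) (hs : 8 / 3 ≤ (3 + c) * g)
    (hcu : 1 - g ≤ c) :
    (3 + c) * (1 - g) ^ 3 * (1 - c * g) ≤ (4 - (3 + c) * g) * c * g ^ 3 := by
  have hg23 : 2 / 3 ≤ g := by nlinarith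
  have e4 : 4 - (3 + c) * g = (1 - c) + (3 + c) * (1 - g) := by ring
  have h1 : (1 - g) ^ 2 * (1 - c * g) ≤ c * g ^ 3 := by
    have hu3 : 1 - g ≤ 1 / 3 := by nlinarith
    have hg3 : (8 : ℝ) / 27 ≤ g ^ 3 := by nlinarith [pow_le_pow_left₀ (by norm_num : (0:ℝ) ≤ 2/3) hg23 3]
    nlinarith [mul_le_mul hcu hu3 (by linarith) hc0.le, mul_nonneg (sq_nonneg (1 - g)) (mul_nonneg hc0.le hg0.le),
      mul_le_mul_of_nonneg_left hg3 hc0.le]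
  rw [e4]
  calc (3 + c) * (1 - g) ^ 3 * (1 - c * g) = ((3 + c) * (1 - g)) * ((1 - g) ^ 2 * (1 - c * g)) := by ring
    _ ≤ ((1 - c) + (3 + c) * (1 - g)) * (c * g ^ 3) :=
        mul_le_mul (by linarith) h1 (mul_nonneg (sq_nonneg _) (by nlinarith [mul_pos hc0 hg0])) (by nlinarith)
    _ = _ := by ring

/-! ### The same inequalities in the form the five-atom lemmas take (times a nonnegative monomial) -/

/-- `HC2` for the four-blob weights: `s/4·p₁ ≤ (1 − s/4)·p₂`, `s = (3+c)g` (used for `s > 2`). [this work] -/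
theorem fourBlobs_hC2 {c g : ℝ} (hc0 : 0 < c) (hc1 : c ≤ 1) (hg0 : 0 < g) (hg1 : g < 1) :
    (3 + c) * g / 4 * (g * (1 - g) ^ 2 * (3 + c - 4 * c * g)) ≤ (1 - (3 + c) * g / 4) * (3 * g ^ 2 * (1 - g) * (1 + c - 2 * c * g)) := by
  have hF : (0 : ℝ) ≤ g ^ 2 * (1 - g) / 4 := div_nonneg (mul_nonneg (sq_nonneg _) (by linarith)) (by norm_num)
  have h := mul_le_mul_of_nonneg_left (fourBlobs_red_C2 c g hc0 hc1 hg0 hg1) hF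
  have e1 : (3 + c) * g / 4 * (g * (1 - g) ^ 2 * (3 + c - 4 * c * g))
      = g ^ 2 * (1 - g) / 4 * ((3 + c) * (1 - g) * (3 + c - 4 * c * g)) := by ring
  have e2 : (1 - (3 + c) * g / 4) * (3 * g ^ 2 * (1 - g) * (1 + c - 2 * c * g))
      = g ^ 2 * (1 - g) / 4 * (3 * (4 - (3 + c) * g) * (1 + c - 2 * c * g)) := by ring
  rw [e1, e2]; exact h
/-- `HS` for the four-blob weights: `s/4·p₁ ≤ (1 − s/4)·p₃`, `s = (3+c)g > 2`. [this work] -/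
theorem fourBlobs_hS {c g : ℝ} (hc0 : 0 < c) (hc1 : c ≤ 1) (hg0 : 0 < g) (hg1 : g < 1) (hs : 2 < (3 + c) * g) :
    (3 + c) * g / 4 * (g * (1 - g) ^ 2 * (3 + c - 4 * c * g)) ≤ (1 - (3 + c) * g / 4) * (g ^ 3 * (1 + 3 * c - 4 * c * g)) := by
  have hF : (0 : ℝ) ≤ g ^ 2 / 4 := by positivity
  have h := mul_le_mul_of_nonneg_left (fourBlobs_red_S c g hc0 hc1 hg1 hs) hF
  have e1 : (3 + c) * g / 4 * (g * (1 - g) ^ 2 * (3 + c - 4 * c * g))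
      = g ^ 2 / 4 * ((3 + c) * (1 - g) ^ 2 * (3 + c - 4 * c * g)) := by ring
  have e2 : (1 - (3 + c) * g / 4) * (g ^ 3 * (1 + 3 * c - 4 * c * g))
      = g ^ 2 / 4 * ((4 - (3 + c) * g) * g * (1 + 3 * c - 4 * c * g)) := by ring
  rw [e1, e2]; exact h
/-- `HZ` for the four-blob weights: `s·(s/4·p₀ − (1 − s/4)·p₄) ≤ (3 − s)·(s/4)·p₃`, `2 < s = (3+c)g < 3`. [this work] -/
theorem fourBlobs_hZ {c g : ℝ} (hc0 : 0 < c) (hc1 : c ≤ 1) (hg0 : 0 < g) (hg1 : g < 1) (hs : 2 < (3 + c) * g) (hs3 : (3 + c) * g < 3) :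
    (3 + c) * g * ((3 + c) * g / 4 * ((1 - g) ^ 3 * (1 - c * g)) - (1 - (3 + c) * g / 4) * (c * g ^ 4)) ≤ (3 - (3 + c) * g) * ((3 + c) * g / 4) * (g ^ 3 * (1 + 3 * c - 4 * c * g)) := by
  have hF : (0 : ℝ) ≤ (3 + c) * g ^ 2 / 4 := by positivity
  have h := mul_le_mul_of_nonneg_left (fourBlobs_red_Z c g hc0 hc1 hg0 hg1 hs hs3) hF
  have e1 : (3 + c) * g * ((3 + c) * g / 4 * ((1 - g) ^ 3 * (1 - c * g)) - (1 - (3 + c) * g / 4) * (c * g ^ 4))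
      = (3 + c) * g ^ 2 / 4 * ((3 + c) * (1 - g) ^ 3 * (1 - c * g) - (4 - (3 + c) * g) * c * g ^ 3) := by ring
  have e2 : (3 - (3 + c) * g) * ((3 + c) * g / 4) * (g ^ 3 * (1 + 3 * c - 4 * c * g))
      = (3 + c) * g ^ 2 / 4 * ((3 - (3 + c) * g) * g ^ 2 * (1 + 3 * c - 4 * c * g)) := by ring
  rw [e1, e2]; exact h
/-- the zero fits under `4k` at the floor gate when `1 − g ≤ c` and `s = (3+c)g ≥ 8/3`: `s/4·p₀ ≤ (1 − s/4)·p₄`. [this work] -/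
theorem fourBlobs_hA_of_ge {c g : ℝ} (hc0 : 0 < c) (hc1 : c ≤ 1) (hg0 : 0 < g) (hg1 : g < 1) (hs : 8 / 3 ≤ (3 + c) * g) (hcu : 1 - g ≤ c) :
    (3 + c) * g / 4 * ((1 - g) ^ 3 * (1 - c * g)) ≤ (1 - (3 + c) * g / 4) * (c * g ^ 4) := by
  have hF : (0 : ℝ) ≤ g / 4 := by positivity
  have h := mul_le_mul_of_nonneg_left (fourBlobs_red_zero c g hc0 hc1 hg0 hg1 hs hcu) hF
  have e1 : (3 + c) * g / 4 * ((1 - g) ^ 3 * (1 - c * g))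
      = g / 4 * ((3 + c) * (1 - g) ^ 3 * (1 - c * g)) := by ring
  have e2 : (1 - (3 + c) * g / 4) * (c * g ^ 4)
      = g / 4 * ((4 - (3 + c) * g) * c * g ^ 3) := by ring
  rw [e1, e2]; exact h
/-- the atom `k` fits under `2k` at gate `s − 2` when `c ≤ 1 − g` and `8/3 ≤ s = (3+c)g < 3`: `(s−2)·p₁ ≤ (3−s)·p₂`. [this work] -/
theorem fourBlobs_hOne_of_le {c g : ℝ} (hc0 : 0 < c) (hg0 : 0 < g) (hg1 : g < 1) (hs : 8 / 3 ≤ (3 + c) * g)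
    (hcu : c ≤ 1 - g) :
    ((3 + c) * g - 2) * (g * (1 - g) ^ 2 * (3 + c - 4 * c * g)) ≤ (3 - (3 + c) * g) * (3 * g ^ 2 * (1 - g) * (1 + c - 2 * c * g)) := by
  have hF : (0 : ℝ) ≤ g * (1 - g) := mul_nonneg hg0.le (by linarith)
  have h := mul_le_mul_of_nonneg_left (fourBlobs_red_one c g hc0 hg1 hs hcu) hF
  have e1 : ((3 + c) * g - 2) * (g * (1 - g) ^ 2 * (3 + c - 4 * c * g))
      = g * (1 - g) * (((3 + c) * g - 2) * (1 - g) * (3 + c - 4 * c * g)) := by ring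
  have e2 : (3 - (3 + c) * g) * (3 * g ^ 2 * (1 - g) * (1 + c - 2 * c * g))
      = g * (1 - g) * (3 * (3 - (3 + c) * g) * g * (1 + c - 2 * c * g)) := by ring
  rw [e1, e2]; exact h

/-- `HO` for the four-blob weights (from `HS`): `s/4·((s−2)p₁ − (3−s)p₂) ≤ (1 − s/4)(s−2)·p₃` for `8/3 ≤ s = (3+c)g ≤ 3`. [this work] -/
theorem fourBlobs_hO {c g : ℝ} (hc0 : 0 < c) (hc1 : c ≤ 1) (hg0 : 0 < g) (hg1 : g < 1) (hs : 8 / 3 ≤ (3 + c) * g)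
    (hs3 : (3 + c) * g < 3) :
    (3 + c) * g / 4 * (((3 + c) * g - 2) * (g * (1 - g) ^ 2 * (3 + c - 4 * c * g)) - (3 - (3 + c) * g) * (3 * g ^ 2 * (1 - g) * (1 + c - 2 * c * g))) ≤ (1 - (3 + c) * g / 4) * ((3 + c) * g - 2) * (g ^ 3 * (1 + 3 * c - 4 * c * g)) := by
  have hS := fourBlobs_hS hc0 hc1 hg0 hg1 (by linarith)
  have hcg : c * g ≤ c := by nlinarith
  have hP2 : (0 : ℝ) ≤ (3 * g ^ 2 * (1 - g) * (1 + c - 2 * c * g)) := mul_nonneg (mul_nonneg (by positivity) (by linarith)) (by linarith)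
  have h1 := mul_le_mul_of_nonneg_left hS (by linarith : (0 : ℝ) ≤ (3 + c) * g - 2)
  have h2 := mul_nonneg (mul_nonneg (by positivity : (0 : ℝ) ≤ (3 + c) * g / 4) (by linarith : (0 : ℝ) ≤ 3 - (3 + c) * g)) hP2
  nlinarith [h1, h2]

/-- the separator of the regime `8/3 ≤ s < 3`: either the zero fits under `4k` at the floor gate or the atom `k` fits under `2k` at gate
`s − 2` (by cases on `c` versus `1 − g`), `8/3 ≤ s`. [this work] -/
theorem fourBlobs_hdisj {c g : ℝ} (hc0 : 0 < c) (hc1 : c ≤ 1) (hg0 : 0 < g) (hg1 : g < 1) (hs : 8 / 3 ≤ (3 + c) * g) :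
    (3 + c) * g / 4 * ((1 - g) ^ 3 * (1 - c * g)) ≤ (1 - (3 + c) * g / 4) * (c * g ^ 4) ∨ ((3 + c) * g - 2) * (g * (1 - g) ^ 2 * (3 + c - 4 * c * g)) ≤ (3 - (3 + c) * g) * (3 * g ^ 2 * (1 - g) * (1 + c - 2 * c * g)) := by
  rcases le_total c (1 - g) with hcu | hcu
  · exact Or.inr (fourBlobs_hOne_of_le hc0 hg0 hg1 hs hcu)
  · exact Or.inl (fourBlobs_hA_of_ge hc0 hc1 hg0 hg1 hs hcu)

/-! ### Four equal blobs at the average gate -/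

/-- **FOUR EQUAL BLOBS ARE HEAVY-DEC AT THEIR AVERAGE GATE.**  For `0 < g < 1`, `0 < c ≤ 1` and a blob size `k`, the law
`(1−c)·[k·Bin(3,g)] + c·[k·Bin(4,g)]` (four independent blobs of size `k` with gates `g, g, g, cg`) on `{0..4k}` is an exact mixture of
components `{lo, hi; γ}` with `γ ≥ (3+c)g/4` and credit `2lo + (hi−lo)γ ≥ (3+c)g·k` (its mean).  Floor `(3+c)g/4` = the average gate; five
regimes of `s = (3+c)g` (`heavy_fiveAtoms_*`) fed with the inequalities above. [this work] -/
theorem heavy_fourBlobs (k : ℕ) {g c : ℝ} (hg0 : 0 < g) (hg1 : g < 1) (hc0 : 0 < c) (hc1 : c ≤ 1) :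
    ∃ (ι : Type) (_ : Fintype ι) (lam γ : ι → ℝ) (lo hi : ι → ℕ),
      (∀ i, 0 ≤ lam i) ∧ (∑ i, lam i = 1) ∧ (∀ i, 0 ≤ γ i ∧ γ i ≤ 1) ∧ (∀ i, lo i ≤ hi i) ∧ (∀ i, hi i ≤ 4 * k) ∧
      (∀ h, ((1 - c) * ((1 - g) ^ 3 * (if h = 0 then (1 : ℝ) else 0) + 3 * g * (1 - g) ^ 2 * (if h = k then (1 : ℝ) else 0) + 3 * g ^ 2 * (1 - g) * (if h = 2 * k then (1 : ℝ) else 0) + g ^ 3 * (if h = 3 * k then (1 : ℝ) else 0))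
            + c * ((1 - g) ^ 4 * (if h = 0 then (1 : ℝ) else 0) + 4 * g * (1 - g) ^ 3 * (if h = k then (1 : ℝ) else 0) + 6 * g ^ 2 * (1 - g) ^ 2 * (if h = 2 * k then (1 : ℝ) else 0)
                + 4 * g ^ 3 * (1 - g) * (if h = 3 * k then (1 : ℝ) else 0) + g ^ 4 * (if h = 4 * k then (1 : ℝ) else 0)))
          = ∑ i, lam i * TP[lo i, hi i, γ i, h]) ∧
      (∀ i, 0 < lam i → (3 + c) * g / 4 ≤ γ i ∧ (3 + c) * g * k ≤ 2 * (lo i : ℝ) + ((hi i : ℝ) - lo i) * γ i) := by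
  -- the five atoms and their mass / mean
  have h1g : 0 < 1 - g := by linarith
  have hcg1 : c * g < 1 := by nlinarith
  have hcg : c * g ≤ c := by nlinarith
  have hp₀0 : (0 : ℝ) ≤ (1 - g) ^ 3 * (1 - c * g) := mul_nonneg (pow_nonneg h1g.le 3) (by linarith)
  have hp₁0 : (0 : ℝ) ≤ g * (1 - g) ^ 2 * (3 + c - 4 * c * g) := mul_nonneg (mul_nonneg hg0.le (sq_nonneg _)) (by linarith)
  have hp₂0 : (0 : ℝ) ≤ 3 * g ^ 2 * (1 - g) * (1 + c - 2 * c * g) := mul_nonneg (mul_nonneg (by positivity) h1g.le) (by linarith)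
  have hp₃0 : (0 : ℝ) ≤ g ^ 3 * (1 + 3 * c - 4 * c * g) := mul_nonneg (pow_nonneg hg0.le 3) (by linarith)
  have hp₄0 : (0 : ℝ) ≤ c * g ^ 4 := by positivity
  have hsum : ((1 - g) ^ 3 * (1 - c * g)) + (g * (1 - g) ^ 2 * (3 + c - 4 * c * g)) + (3 * g ^ 2 * (1 - g) * (1 + c - 2 * c * g)) + (g ^ 3 * (1 + 3 * c - 4 * c * g)) + (c * g ^ 4) = 1 := by
    ring
  have hmean : (g * (1 - g) ^ 2 * (3 + c - 4 * c * g)) + 2 * (3 * g ^ 2 * (1 - g) * (1 + c - 2 * c * g)) + 3 * (g ^ 3 * (1 + 3 * c - 4 * c * g)) + 4 * (c * g ^ 4)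
      = (3 + c) * g := by
    ring
  have hs0 : 0 < (3 + c) * g := by positivity
  have hlaw : ∀ h : ℕ, ((1 - c) * ((1 - g) ^ 3 * (if h = 0 then (1 : ℝ) else 0) + 3 * g * (1 - g) ^ 2 * (if h = k then (1 : ℝ) else 0) + 3 * g ^ 2 * (1 - g) * (if h = 2 * k then (1 : ℝ) else 0) + g ^ 3 * (if h = 3 * k then (1 : ℝ) else 0))
            + c * ((1 - g) ^ 4 * (if h = 0 then (1 : ℝ) else 0) + 4 * g * (1 - g) ^ 3 * (if h = k then (1 : ℝ) else 0) + 6 * g ^ 2 * (1 - g) ^ 2 * (if h = 2 * k then (1 : ℝ) else 0)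
                + 4 * g ^ 3 * (1 - g) * (if h = 3 * k then (1 : ℝ) else 0) + g ^ 4 * (if h = 4 * k then (1 : ℝ) else 0)))
      = ((1 - g) ^ 3 * (1 - c * g) * (if h = 0 then (1 : ℝ) else 0) + g * (1 - g) ^ 2 * (3 + c - 4 * c * g) * (if h = k then (1 : ℝ) else 0) + 3 * g ^ 2 * (1 - g) * (1 + c - 2 * c * g) * (if h = 2 * k then (1 : ℝ) else 0)
          + g ^ 3 * (1 + 3 * c - 4 * c * g) * (if h = 3 * k then (1 : ℝ) else 0) + c * g ^ 4 * (if h = 4 * k then (1 : ℝ) else 0)) :=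
    fun h => by ring
  -- the five regimes of `s = (3+c)g`
  have main : ∃ (ι : Type) (_ : Fintype ι) (lam γ : ι → ℝ) (lo hi : ι → ℕ),
      (∀ i, 0 ≤ lam i) ∧ (∑ i, lam i = 1) ∧ (∀ i, 0 ≤ γ i ∧ γ i ≤ 1) ∧ (∀ i, lo i ≤ hi i) ∧ (∀ i, hi i ≤ 4 * k) ∧
      (∀ h, ((1 - g) ^ 3 * (1 - c * g) * (if h = 0 then (1 : ℝ) else 0) + g * (1 - g) ^ 2 * (3 + c - 4 * c * g) * (if h = k then (1 : ℝ) else 0) + 3 * g ^ 2 * (1 - g) * (1 + c - 2 * c * g) * (if h = 2 * k then (1 : ℝ) else 0)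
          + g ^ 3 * (1 + 3 * c - 4 * c * g) * (if h = 3 * k then (1 : ℝ) else 0) + c * g ^ 4 * (if h = 4 * k then (1 : ℝ) else 0))
          = ∑ i, lam i * TP[lo i, hi i, γ i, h]) ∧
      (∀ i, 0 < lam i → (3 + c) * g / 4 ≤ γ i ∧ (3 + c) * g * k ≤ 2 * (lo i : ℝ) + ((hi i : ℝ) - lo i) * γ i) := by
    rcases le_or_gt ((3 + c) * g) 1 with h1 | h1
    · exact heavy_fiveAtoms_r1 k _ _ _ _ _ _ hp₀0 hp₁0 hp₂0 hp₃0 hp₄0 hsum hmean hs0 h1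
    rcases le_or_gt ((3 + c) * g) 2 with h2 | h2
    · exact heavy_fiveAtoms_r2 k _ _ _ _ _ _ hp₀0 hp₁0 hp₂0 hp₃0 hp₄0 hsum hmean hs0 h1 h2
    rcases le_or_gt ((3 + c) * g) (8 / 3) with h83 | h83
    · exact heavy_fiveAtoms_r3lo k _ _ _ _ _ _ hp₀0 hp₁0 hp₂0 hp₃0 hp₄0 hsum hmean hs0 h2 h83 (fourBlobs_hC2 hc0 hc1 hg0 hg1)
        (fourBlobs_hZ hc0 hc1 hg0 hg1 h2 (by linarith))
    rcases lt_or_ge ((3 + c) * g) 3 with h3 | h3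
    · exact heavy_fiveAtoms_r3hi k _ _ _ _ _ _ hp₀0 hp₁0 hp₂0 hp₃0 hp₄0 hsum hmean hs0 h83.le h3 (fourBlobs_hZ hc0 hc1 hg0 hg1 h2 h3)
        (fourBlobs_hO hc0 hc1 hg0 hg1 h83.le h3) (fourBlobs_hdisj hc0 hc1 hg0 hg1 h83.le)
    · have h4 : (3 + c) * g < 4 := by nlinarith
      have hcu : 1 - g ≤ c := by nlinarith
      exact heavy_fiveAtoms_r4 k _ _ _ _ _ _ hp₀0 hp₁0 hp₂0 hp₃0 hp₄0 hsum hmean hs0 h3 h4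
        (fourBlobs_hA_of_ge hc0 hc1 hg0 hg1 (by linarith) hcu) (fourBlobs_hS hc0 hc1 hg0 hg1 (by linarith))
  obtain ⟨ι, hι, lam, γ, lo, hi, h0, h1, hγ, hlohi, hhi, hμ, hval⟩ := main
  exact ⟨ι, hι, lam, γ, lo, hi, h0, h1, hγ, hlohi, hhi, fun h => (hlaw h).trans (hμ h), hval⟩

/-! ### The fourth convolution power of the glued sibling, and the lift atom by atom -/

/-- `ρ ∗ ρ ∗ ρ ∗ ρ = Σ_b C(4,b) g^b (1−g)^{4−b} · δ_{4r+bk}`. [this work] -/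
theorem glued_fourth_apply (r k : ℕ) (g : ℝ) (h : ℕ) :
    lconv ((r + k) + (r + k) + (r + k)) (r + k) (lconv ((r + k) + (r + k)) (r + k) (lconv (r + k) (r + k) (blobLaw [(k, g), (r, 1)]) (blobLaw [(k, g), (r, 1)])) (blobLaw [(k, g), (r, 1)]))
        (blobLaw [(k, g), (r, 1)]) h
      = (1 - g) ^ 4 * pointLaw (4 * r) h + 4 * g * (1 - g) ^ 3 * pointLaw (4 * r + k) h
        + 6 * g ^ 2 * (1 - g) ^ 2 * pointLaw (4 * r + 2 * k) h + 4 * g ^ 3 * (1 - g) * pointLaw (4 * r + 3 * k) h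
        + g ^ 4 * pointLaw (4 * r + 4 * k) h := by
  have e3 : (lconv ((r + k) + (r + k)) (r + k) (lconv (r + k) (r + k) (blobLaw [(k, g), (r, 1)]) (blobLaw [(k, g), (r, 1)])) (blobLaw [(k, g), (r, 1)]))
      = fun h => (1 - g) ^ 3 * pointLaw (3 * r) h + 3 * g * (1 - g) ^ 2 * pointLaw (3 * r + k) h
          + 3 * g ^ 2 * (1 - g) * pointLaw (3 * r + 2 * k) h + g ^ 3 * pointLaw (3 * r + 3 * k) h := funext (glued_cube_apply r k g)
  rw [e3, glued_eq_pointLaws, lconv_lin4_left, lconv_lin_right, lconv_lin_right, lconv_lin_right, lconv_lin_right,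
    lconv_pointLaw _ _ (3 * r) r (by omega) (by omega), lconv_pointLaw _ _ (3 * r) (k + r) (by omega) (by omega),
    lconv_pointLaw _ _ (3 * r + k) r (by omega) (by omega), lconv_pointLaw _ _ (3 * r + k) (k + r) (by omega) (by omega),
    lconv_pointLaw _ _ (3 * r + 2 * k) r (by omega) (by omega),
    lconv_pointLaw _ _ (3 * r + 2 * k) (k + r) (by omega) (by omega),
    lconv_pointLaw _ _ (3 * r + 3 * k) r (by omega) (by omega),
    lconv_pointLaw _ _ (3 * r + 3 * k) (k + r) (by omega) (by omega),
    show 3 * r + r = 4 * r by ring, show 3 * r + (k + r) = 4 * r + k by ring, show 3 * r + k + r = 4 * r + k by ring,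
    show 3 * r + k + (k + r) = 4 * r + 2 * k by ring, show 3 * r + 2 * k + r = 4 * r + 2 * k by ring,
    show 3 * r + 2 * k + (k + r) = 4 * r + 3 * k by ring, show 3 * r + 3 * k + r = 4 * r + 3 * k by ring,
    show 3 * r + 3 * k + (k + r) = 4 * r + 4 * k by ring]
  ring

/-- **`X₃ = ρ ∗ ρ ∗ ρ ∗ gate_c ρ` atom by atom**: `(1−c)·ρ^{∗3} + c·ρ^{∗4}`. [this work] -/
theorem threeSureOneGated_apply (r k : ℕ) (g c : ℝ) (h : ℕ) :
    lconv ((r + k) + (r + k) + (r + k)) (r + k) (lconv ((r + k) + (r + k)) (r + k) (lconv (r + k) (r + k) (blobLaw [(k, g), (r, 1)]) (blobLaw [(k, g), (r, 1)])) (blobLaw [(k, g), (r, 1)]))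
        (gate (blobLaw [(k, g), (r, 1)]) c) h
      = (1 - c) * ((1 - g) ^ 3 * pointLaw (3 * r) h + 3 * g * (1 - g) ^ 2 * pointLaw (3 * r + k) h
            + 3 * g ^ 2 * (1 - g) * pointLaw (3 * r + 2 * k) h + g ^ 3 * pointLaw (3 * r + 3 * k) h)
        + c * ((1 - g) ^ 4 * pointLaw (4 * r) h + 4 * g * (1 - g) ^ 3 * pointLaw (4 * r + k) h
            + 6 * g ^ 2 * (1 - g) ^ 2 * pointLaw (4 * r + 2 * k) h + 4 * g ^ 3 * (1 - g) * pointLaw (4 * r + 3 * k) h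
            + g ^ 4 * pointLaw (4 * r + 4 * k) h) := by
  rw [lconv_gate_right _ _ _ _ _ (fun t ht => lconv_eq_zero _ _ _ _ t ht) h, glued_fourth_apply, glued_cube_apply]
  ring

/-- **the same law as the doubly shifted blob law**: `X₃ h = [3r ≤ h]·( (1−c)B₃(h−3r) + [r ≤ h−3r]·c·B₄(h−4r) )`, `B₃ = k·Bin(3,g)`,
`B₄ = k·Bin(4,g)` on the atoms `0, k, 2k, 3k, 4k`. [this work] -/
theorem threeSureOneGated_eq_shift (r k : ℕ) (g c : ℝ) (h : ℕ) :
    lconv ((r + k) + (r + k) + (r + k)) (r + k) (lconv ((r + k) + (r + k)) (r + k) (lconv (r + k) (r + k) (blobLaw [(k, g), (r, 1)]) (blobLaw [(k, g), (r, 1)])) (blobLaw [(k, g), (r, 1)]))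
        (gate (blobLaw [(k, g), (r, 1)]) c) h
      = (if 3 * r ≤ h then
          ((fun t => (1 - c) * ((1 - g) ^ 3 * (if t = 0 then (1 : ℝ) else 0) + 3 * g * (1 - g) ^ 2 * (if t = k then (1 : ℝ) else 0) + 3 * g ^ 2 * (1 - g) * (if t = 2 * k then (1 : ℝ) else 0) + g ^ 3 * (if t = 3 * k then (1 : ℝ) else 0))) (h - 3 * r)
            + (if r ≤ h - 3 * r then
                (fun t => c * ((1 - g) ^ 4 * (if t = 0 then (1 : ℝ) else 0) + 4 * g * (1 - g) ^ 3 * (if t = k then (1 : ℝ) else 0) + 6 * g ^ 2 * (1 - g) ^ 2 * (if t = 2 * k then (1 : ℝ) else 0)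
                + 4 * g ^ 3 * (1 - g) * (if t = 3 * k then (1 : ℝ) else 0) + g ^ 4 * (if t = 4 * k then (1 : ℝ) else 0)))
                  (h - 3 * r - r)
              else 0))
        else 0) := by
  rw [threeSureOneGated_apply]
  simp only [pointLaw]
  by_cases h3 : 3 * r ≤ h
  · rw [if_pos h3]
    rw [ind_sub h3 0, ind_sub h3 k, ind_sub h3 (2 * k), ind_sub h3 (3 * k), show 3 * r + 0 = 3 * r by ring]
    by_cases h4 : r ≤ h - 3 * r
    · rw [if_pos h4]
      have h4' : 3 * r + r ≤ h := by omega
      have esub : h - 3 * r - r = h - (3 * r + r) := by omega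
      rw [esub, ind_sub h4' 0, ind_sub h4' k, ind_sub h4' (2 * k), ind_sub h4' (3 * k), ind_sub h4' (4 * k),
        show 3 * r + r + 0 = 4 * r by ring, show 3 * r + r + k = 4 * r + k by ring, show 3 * r + r + 2 * k = 4 * r + 2 * k by ring,
        show 3 * r + r + 3 * k = 4 * r + 3 * k by ring, show 3 * r + r + 4 * k = 4 * r + 4 * k by ring]
    · rw [if_neg h4, if_neg (show ¬ (h = 4 * r) by omega), if_neg (show ¬ (h = 4 * r + k) by omega),
        if_neg (show ¬ (h = 4 * r + 2 * k) by omega), if_neg (show ¬ (h = 4 * r + 3 * k) by omega),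
        if_neg (show ¬ (h = 4 * r + 4 * k) by omega)]
      ring
  · rw [if_neg h3, if_neg (show ¬ (h = 3 * r) by omega), if_neg (show ¬ (h = 3 * r + k) by omega),
      if_neg (show ¬ (h = 3 * r + 2 * k) by omega), if_neg (show ¬ (h = 3 * r + 3 * k) by omega), if_neg (show ¬ (h = 4 * r) by omega),
      if_neg (show ¬ (h = 4 * r + k) by omega), if_neg (show ¬ (h = 4 * r + 2 * k) by omega), if_neg (show ¬ (h = 4 * r + 3 * k) by omega),
      if_neg (show ¬ (h = 4 * r + 4 * k) by omega)]
    ring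

/-! ### The lift: `ρ ∗ ρ ∗ ρ ∗ gate_c ρ` is DEC at floor `(3+c)g/4` at every layer -/

/-- **THE LIFT `ρ ∗ ρ ∗ ρ ∗ gate_c ρ` AT FLOOR `(3+c)g/4` (three sure glued siblings `ρ = blobLaw [(k,g),(r,1)]` beside a `c`-gated copy).**
For `0 < g < 1`, `0 < c ≤ 1` and every layer `j`: `DECAtT ((3+c)g/4) ((3+c)(r+kg)) j (4(r+k)) (ρ ∗ ρ ∗ ρ ∗ gate_c ρ)` — DEC at its own mean at
a floor ABOVE the forest's natural floor `c·g`, for EVERY shape `(r, k)`.  Proof: the four-blob law at its average gate (`heavy_fourBlobs`),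
the gated copy's atoms moved up by `r` (`heavy_shift_partial`), everything moved up by `3r` (`heavy_shift_full`, target `+6r ≥ (3+c)r`), read
back as `X₃` (`threeSureOneGated_eq_shift`), valid at every layer (`decAtT_of_heavy`). [this work] -/
theorem decAtT_threeSureOneGated (r k : ℕ) {g c : ℝ} (hg0 : 0 < g) (hg1 : g < 1) (hc0 : 0 < c) (hc1 : c ≤ 1) (j : ℕ) :
    DECAtT ((3 + c) * g / 4) ((3 + c) * ((r : ℝ) + k * g)) j ((r + k) + (r + k) + (r + k) + (r + k))
      (lconv ((r + k) + (r + k) + (r + k)) (r + k) (lconv ((r + k) + (r + k)) (r + k) (lconv (r + k) (r + k) (blobLaw [(k, g), (r, 1)]) (blobLaw [(k, g), (r, 1)])) (blobLaw [(k, g), (r, 1)]))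
        (gate (blobLaw [(k, g), (r, 1)]) c)) := by
  have hx1 : (3 + c) * g / 4 ≤ 1 := by nlinarith
  have h1g : 0 ≤ 1 - g := by linarith
  -- the four blobs at their average gate
  have hB := heavy_fourBlobs k hg0 hg1 hc0 hc1
  -- move the gated copy's blobs up by `r`
  have hind : ∀ t a : ℕ, (0 : ℝ) ≤ (if t = a then (1 : ℝ) else 0) := fun t a => by split_ifs <;> norm_num
  have hP := heavy_shift_partial ((3 + c) * g / 4) ((3 + c) * g * k) (4 * k) r _
    (fun t => (1 - c) * ((1 - g) ^ 3 * (if t = 0 then (1 : ℝ) else 0) + 3 * g * (1 - g) ^ 2 * (if t = k then (1 : ℝ) else 0) + 3 * g ^ 2 * (1 - g) * (if t = 2 * k then (1 : ℝ) else 0) + g ^ 3 * (if t = 3 * k then (1 : ℝ) else 0)))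
    (fun t => c * ((1 - g) ^ 4 * (if t = 0 then (1 : ℝ) else 0) + 4 * g * (1 - g) ^ 3 * (if t = k then (1 : ℝ) else 0) + 6 * g ^ 2 * (1 - g) ^ 2 * (if t = 2 * k then (1 : ℝ) else 0)
                + 4 * g ^ 3 * (1 - g) * (if t = 3 * k then (1 : ℝ) else 0) + g ^ 4 * (if t = 4 * k then (1 : ℝ) else 0)))
    hx1 (fun t => rfl)
    (fun t => mul_nonneg (by linarith) (add_nonneg (add_nonneg (add_nonneg (mul_nonneg (pow_nonneg h1g 3) (hind t 0))
      (mul_nonneg (mul_nonneg (by linarith) (sq_nonneg _)) (hind t k))) (mul_nonneg (mul_nonneg (by positivity) h1g) (hind t (2 * k))))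
      (mul_nonneg (pow_nonneg hg0.le 3) (hind t (3 * k)))))
    (fun t => mul_nonneg hc0.le (add_nonneg (add_nonneg (add_nonneg (add_nonneg (mul_nonneg (pow_nonneg h1g 4) (hind t 0))
      (mul_nonneg (mul_nonneg (by linarith) (pow_nonneg h1g 3)) (hind t k)))
      (mul_nonneg (mul_nonneg (by positivity) (sq_nonneg _)) (hind t (2 * k))))
      (mul_nonneg (mul_nonneg (by positivity) h1g) (hind t (3 * k)))) (mul_nonneg (pow_nonneg hg0.le 4) (hind t (4 * k)))))
    hB
  -- move everything up by `3r`: target `+ 6r`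
  have hF := heavy_shift_full ((3 + c) * g / 4) ((3 + c) * g * k) (4 * k + r) (3 * r) _ hP
  -- read the shifted law as `X₃` and conclude at every layer
  have hD := decAtT_of_heavy ((3 + c) * g / 4) ((3 + c) * g * k + 2 * ((3 * r : ℕ) : ℝ)) (4 * k + r + 3 * r) _ hF j
  have e : (fun h : ℕ => if 3 * r ≤ h then
          ((fun t => (1 - c) * ((1 - g) ^ 3 * (if t = 0 then (1 : ℝ) else 0) + 3 * g * (1 - g) ^ 2 * (if t = k then (1 : ℝ) else 0) + 3 * g ^ 2 * (1 - g) * (if t = 2 * k then (1 : ℝ) else 0) + g ^ 3 * (if t = 3 * k then (1 : ℝ) else 0))) (h - 3 * r)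
            + (if r ≤ h - 3 * r then
                (fun t => c * ((1 - g) ^ 4 * (if t = 0 then (1 : ℝ) else 0) + 4 * g * (1 - g) ^ 3 * (if t = k then (1 : ℝ) else 0) + 6 * g ^ 2 * (1 - g) ^ 2 * (if t = 2 * k then (1 : ℝ) else 0)
                + 4 * g ^ 3 * (1 - g) * (if t = 3 * k then (1 : ℝ) else 0) + g ^ 4 * (if t = 4 * k then (1 : ℝ) else 0)))
                  (h - 3 * r - r)
              else 0))
        else 0)
      = lconv ((r + k) + (r + k) + (r + k)) (r + k) (lconv ((r + k) + (r + k)) (r + k) (lconv (r + k) (r + k) (blobLaw [(k, g), (r, 1)]) (blobLaw [(k, g), (r, 1)])) (blobLaw [(k, g), (r, 1)]))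
        (gate (blobLaw [(k, g), (r, 1)]) c) := funext fun h => (threeSureOneGated_eq_shift r k g c h).symm
  rw [e] at hD
  have hT : (3 + c) * ((r : ℝ) + k * g) ≤ (3 + c) * g * k + 2 * ((3 * r : ℕ) : ℝ) := by
    have hr0 : (0 : ℝ) ≤ r := Nat.cast_nonneg r
    push_cast; nlinarith [mul_nonneg hr0 (by linarith : (0 : ℝ) ≤ 3 - c)]
  have hM : 4 * k + r + 3 * r ≤ (r + k) + (r + k) + (r + k) + (r + k) := by omega
  exact decAtT_mono_top (decAtT_antitone_target hT hD) hM

end LawDec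
end Quant
end Summit.CriticalPhenomena.PercolationContinuityZ3.Theorems
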